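import Literature.NumberTheory.Sieve.MaynardCollatzWielandt
import Mathlib.Algebra.Order.Chebyshev
import HarnessLib

/-!
# Polymath 8b Lemma 6.1 with weights of ORDER TWO: the dual bound for `M_k` from weights
# `G_m = ψ(t_m; ℓ_m, q_m)` and its polynomial-majorant (dual certificate) form

Topic `Literature/NumberTheory/Sieve`; companion of `MaynardCollatzWielandt.lean` (`maynardFunctional_le_of_weights`,
Polymath 8b Lemma 6.1 for the plain functional with general weights) and of `MaynardOrderOneCollapse.lean` (weights
depending on `t_m` and the fibre length `ℓ_m = 1 - ∑_{j≠m} t_j` only).  Here the weights may also depend on the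
second fibre invariant `q_m = ∑_{j≠m} t_j²`: `G_m(t) = ψ(t_m, ℓ_m, q_m)`.  Both `ℓ_m` and `q_m` are constant along the
`t_m`-fibre, so the normalisation `∫₀^∞ G_m dt_m ≤ 1` of Lemma 6.1 ("for all `t_1,…,t_{m-1},t_{m+1},…,t_k ≥ 0`",
proof of Cor. 6.4, §6) is again a one-variable condition `∫_{(0,ℓ]} ψ(u, ℓ, q) du ≤ 1`, now for every REALISABLE pair
`(ℓ, q)` (`0 ≤ ℓ ≤ 1`, `(1-ℓ)²/n ≤ q ≤ (1-ℓ)²` by Cauchy–Schwarz), and at a point `t ∈ R_{n+1}` with `∑ t = σ`,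
`∑ t² = Q` the pointwise sum of Lemma 6.1 is `∑_m Φ_{σ,Q}(t_m)` with the ORDER-TWO PAYOFF
`Φ_{σ,Q}(u) = 1/ψ(u, 1-σ+u, Q-u²)`.

* `MaynardCW.orderTwoPayoff ψ σ Q u` — `Φ_{σ,Q}(u)` (zero for `u ≤ 0`, where `G_m` is extended by zero);
* `MaynardCW.maynardFunctional_le_of_orderTwoPayoff_sum_le` — Lemma 6.1 for order-two weights: fibre budgets on the
  realisable `(ℓ,q)` + `∑_m Φ_{∑t,∑t²}(t_m) ≤ Λ` on `R_{n+1}` ⇒ `M_{n+1} ≤ Λ`;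
* `maynardFunctional_le_of_orderTwo_dual` — the DUAL CERTIFICATE form: if for every realisable `(σ,Q)`
  (`0 ≤ σ ≤ 1`, `σ²/(n+1) ≤ Q ≤ σ²`) there are `a, b, c` with `Φ_{σ,Q}(u) ≤ c + a u + b u²` for all realisable
  `u` (`0 ≤ u ≤ σ`, `u² ≤ Q`, `(σ-u)²/n ≤ Q-u² ≤ (σ-u)²`) and `(n+1)c + aσ + bQ ≤ Λ`, then `M_{n+1} ≤ Λ` — because
  `∑_m (c + a t_m + b t_m²) = (n+1)c + aσ + bQ`.  This is a five-dimensional condition (`σ, Q` and the three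
  coefficients, checked against one variable `u`) replacing the `(n+1)`-dimensional supremum of Lemma 6.1.

The order-one case (`ψ` independent of `q`, `b = 0`) with the weights of Corollary 6.4 recovers `M_k ≤ (k/(k-1)) log k`
(there `Φ` is itself linear in `u`).  No new named facts.

## References
* [Polymath8b2014] D. H. J. Polymath, *Variants of the Selberg sieve, and bounded intervals containing many
  primes*, Res. Math. Sci. 1:12 (2014) = arXiv:1407.4897v4, Lemma 6.1 and the proof of Corollary 6.4 (§6).
* [HardyLittlewoodPolya1952] G. H. Hardy, J. E. Littlewood, G. Pólya, *Inequalities*, 2nd ed., Cambridge University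
  Press (1952), §2.4 Thm. 7, p. 16 (Cauchy's inequality `(∑ab)² ≤ ∑a² ∑b²`), used with `b = 1`: `(∑_{j∈s} a_j)² ≤ #s·∑ a_j²`
  (Mathlib `sq_sum_le_card_mul_sum_sq`).
-/

noncomputable section

open MeasureTheory Set Filter Finset
open scoped ENNReal BigOperators

namespace Literature.NumberTheory.Sieve

namespace MaynardCW

variable {n : ℕ}

/-! ### Fibre invariants of order two -/

/-- `∑_{j≠m} t_j² = ∑_j t_j² - t_m²`: the second fibre invariant `q_m` in terms of `Q = ∑ t²` and `t_m`.
[cite: Polymath8b2014, Lemma 6.1 and proof of Corollary 6.4 (§6)] -/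
theorem sum_erase_sq_eq (m : Fin (n + 1)) (t : Fin (n + 1) → ℝ) :
    ∑ j ∈ univ.erase m, t j ^ 2 = ∑ j, t j ^ 2 - t m ^ 2 := by
  rw [← Finset.add_sum_erase _ (fun j => t j ^ 2) (Finset.mem_univ m)]; ring

/-- `∑_{j≠m} t_j = ∑_j t_j - t_m`. [cite: Polymath8b2014, Lemma 6.1 and proof of Corollary 6.4 (§6)] -/
theorem sum_erase_eq (m : Fin (n + 1)) (t : Fin (n + 1) → ℝ) :
    ∑ j ∈ univ.erase m, t j = ∑ j, t j - t m := by
  rw [← Finset.add_sum_erase _ t (Finset.mem_univ m)]; ring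

/-- On a fibre over the outer point `s`: `∑_{j≠m} (insertNth m u s)_j² = ∑_j s_j²` — the second fibre invariant
does not depend on `t_m`. [cite: Polymath8b2014, Lemma 6.1 and proof of Corollary 6.4 (§6)] -/
theorem sum_erase_sq_insertNth (m : Fin (n + 1)) (u : ℝ) (s : Fin n → ℝ) :
    ∑ j ∈ univ.erase m, Fin.insertNth (α := fun _ => ℝ) m u s j ^ 2 = ∑ j, s j ^ 2 := by
  rw [sum_erase_sq_eq, Fin.sum_univ_succAbove _ m]
  simp only [Fin.insertNth_apply_same, Fin.insertNth_apply_succAbove]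
  ring

/-- Cauchy–Schwarz on the complement of one coordinate: `(∑_{j≠m} t_j)² ≤ n · ∑_{j≠m} t_j²`.
[cite: HardyLittlewoodPolya1952, §2.4 Thm. 7 (Cauchy's inequality), with b_j = 1] -/
theorem sq_sum_erase_le (m : Fin (n + 1)) (t : Fin (n + 1) → ℝ) :
    (∑ j ∈ univ.erase m, t j) ^ 2 ≤ (n:ℝ) * ∑ j ∈ univ.erase m, t j ^ 2 := by
  have h := sq_sum_le_card_mul_sum_sq (s := univ.erase m) (f := t)
  rwa [Finset.card_erase_of_mem (Finset.mem_univ m), Finset.card_univ, Fintype.card_fin,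
    Nat.add_sub_cancel] at h

/-- Cauchy–Schwarz over `Fin n`: `(∑ s_j)² ≤ n · ∑ s_j²`.
[cite: HardyLittlewoodPolya1952, §2.4 Thm. 7 (Cauchy's inequality), with b_j = 1] -/
theorem sq_sum_le_mul_sum_sq (s : Fin n → ℝ) : (∑ j, s j) ^ 2 ≤ (n:ℝ) * ∑ j, s j ^ 2 := by
  have h := sq_sum_le_card_mul_sum_sq (s := (univ : Finset (Fin n))) (f := s)
  rwa [Finset.card_univ, Fintype.card_fin] at h

/-! ### Order-two payoff and Lemma 6.1 for order-two weights -/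

/-- The ORDER-TWO PAYOFF `Φ_{σ,Q}(u) = 1/ψ(u, 1-σ+u, Q-u²)`: the summand `1/G_m(t)` of Polymath 8b Lemma 6.1 for
weights `G_m(t) = ψ(t_m, ℓ_m, q_m)` depending on `t_m` and the two fibre invariants `ℓ_m = 1 - ∑_{j≠m} t_j = 1 - σ + t_m`,
`q_m = ∑_{j≠m} t_j² = Q - t_m²` (`σ = ∑ t`, `Q = ∑ t²`); zero for `u ≤ 0` (the face `t_m = 0`, where `G_m` is extended
by zero). [cite: Polymath8b2014, Lemma 6.1 and proof of Corollary 6.4 (§6)] -/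
def orderTwoPayoff (ψ : ℝ → ℝ → ℝ → ℝ) (σ Q u : ℝ) : ℝ :=
  if 0 < u then (ψ u (1 - σ + u) (Q - u ^ 2))⁻¹ else 0

/-- [cite: Polymath8b2014, Lemma 6.1 and proof of Corollary 6.4 (§6)] -/
theorem orderTwoPayoff_of_pos (ψ : ℝ → ℝ → ℝ → ℝ) {σ Q u : ℝ} (hu : 0 < u) :
    orderTwoPayoff ψ σ Q u = (ψ u (1 - σ + u) (Q - u ^ 2))⁻¹ := if_pos hu

/-- [cite: Polymath8b2014, Lemma 6.1 and proof of Corollary 6.4 (§6)] -/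
theorem orderTwoPayoff_of_not_pos (ψ : ℝ → ℝ → ℝ → ℝ) {σ Q u : ℝ} (hu : ¬ 0 < u) :
    orderTwoPayoff ψ σ Q u = 0 := if_neg hu

/-- **Polymath 8b Lemma 6.1 for order-two weights.**  Let `ψ : ℝ³ → ℝ` be jointly measurable, with
`ψ(u, ℓ, q) > 0` whenever `0 < u ≤ ℓ ≤ 1` and `(1-ℓ)² ≤ n q`, `q ≤ (1-ℓ)²` (the realisable fibre invariants), and with
fibre budgets `∫_{(0,ℓ]} ψ(u, ℓ, q) du ≤ 1` for all such `(ℓ, q)` with `0 ≤ ℓ ≤ 1` (the normalisation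
`∫₀^∞ G_m dt_m ≤ 1` of Lemma 6.1 for `G_m(t) = ψ(t_m, 1-∑_{j≠m}t_j, ∑_{j≠m}t_j²)`).  If `Λ ≥ 0` and
`∑_m Φ_{∑t, ∑t²}(t_m) ≤ Λ` for every `t ∈ R_{n+1}`, then `(∑_m J^{(m)}_{n+1}(F))/I_{n+1}(F) ≤ Λ` for every admissible
`F`, so `M_{n+1} ≤ Λ`. [cite: Polymath8b2014, Lemma 6.1 and proof of Corollary 6.4 (§6)] -/
theorem maynardFunctional_le_of_orderTwoPayoff_sum_le {Λ : ℝ} (ψ : ℝ → ℝ → ℝ → ℝ)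
    (hψm : Measurable fun p : ℝ × ℝ × ℝ => ψ p.1 p.2.1 p.2.2)
    (hψpos : ∀ u ℓ q : ℝ, 0 < u → u ≤ ℓ → ℓ ≤ 1 → (1 - ℓ) ^ 2 ≤ (n:ℝ) * q → q ≤ (1 - ℓ) ^ 2 →
      0 < ψ u ℓ q)
    (hnorm : ∀ ℓ q : ℝ, 0 ≤ ℓ → ℓ ≤ 1 → (1 - ℓ) ^ 2 ≤ (n:ℝ) * q → q ≤ (1 - ℓ) ^ 2 →
      ∫⁻ u in Ioc (0:ℝ) ℓ, ENNReal.ofReal (ψ u ℓ q) ≤ 1)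
    (hΛ0 : 0 ≤ Λ)
    (hpt : ∀ t ∈ maynardSimplex (n + 1), ∑ m, orderTwoPayoff ψ (∑ j, t j) (∑ j, t j ^ 2) (t m) ≤ Λ)
    {F : (Fin (n + 1) → ℝ) → ℝ} (hF : IsMaynardAdmissible (n + 1) F) :
    maynardFunctional (n + 1) F ≤ Λ := by
  -- the order-two weights
  set w : Fin (n + 1) → (Fin (n + 1) → ℝ) → ℝ :=
    fun m t => (ψ (t m) (1 - ∑ j ∈ univ.erase m, t j) (∑ j ∈ univ.erase m, t j ^ 2))⁻¹ with hw
  have hwm : ∀ m, Measurable (w m) := by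
    intro m
    have h1 : Measurable fun t : Fin (n + 1) → ℝ =>
        (t m, 1 - ∑ j ∈ univ.erase m, t j, ∑ j ∈ univ.erase m, t j ^ 2) :=
      (measurable_pi_apply m).prodMk
        ((measurable_const.sub (Finset.measurable_sum _ fun j _ => measurable_pi_apply j)).prodMk
          (Finset.measurable_sum _ fun j _ => (measurable_pi_apply j).pow_const 2))
    exact (hψm.comp h1).inv
  refine maynardFunctional_le_of_weights hΛ0 hF w hwm ?_ ?_ ?_
  · -- positivity where `F ≠ 0`, `t_m > 0`: the arguments are realisable
    intro m t hFt htm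
    have ht : t ∈ maynardSimplex (n + 1) := hF.support_subset (Function.mem_support.2 hFt)
    have hs0 : 0 ≤ ∑ j ∈ univ.erase m, t j := Finset.sum_nonneg fun j _ => ht.1 j
    have hs1 : ∑ j ∈ univ.erase m, t j + t m = ∑ j, t j := by rw [sum_erase_eq]; ring
    simp only [hw]
    refine inv_pos.2 (hψpos _ _ _ htm ?_ ?_ ?_ ?_)
    · linarith [ht.2]
    · linarith
    · rw [sub_sub_cancel]; exact sq_sum_erase_le m t
    · rw [sub_sub_cancel]; exact Finset.sum_sq_le_sq_sum_of_nonneg fun j _ => ht.1 j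
  · -- fibre budgets: `ℓ = 1 - ∑ s`, `q = ∑ s²` along the whole fibre
    intro m s hs0 hs1
    have hsum : 0 ≤ ∑ j, s j := Finset.sum_nonneg fun j _ => hs0 j
    calc ∫⁻ u in Ioc (0:ℝ) (1 - ∑ j, s j), ENNReal.ofReal (w m (Fin.insertNth m u s))⁻¹
        = ∫⁻ u in Ioc (0:ℝ) (1 - ∑ j, s j), ENNReal.ofReal (ψ u (1 - ∑ j, s j) (∑ j, s j ^ 2)) := by
          refine setLIntegral_congr_fun measurableSet_Ioc fun u hu => ?_
          simp only [hw, sub_sum_erase_insertNth, sum_erase_sq_insertNth, Fin.insertNth_apply_same, inv_inv]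
      _ ≤ 1 := by
          refine hnorm _ _ (by linarith) (by linarith) ?_ ?_
          · rw [sub_sub_cancel]; exact sq_sum_le_mul_sum_sq s
          · rw [sub_sub_cancel]; exact Finset.sum_sq_le_sq_sum_of_nonneg fun j _ => hs0 j
  · -- the pointwise sum of Lemma 6.1 is `∑_m Φ_{σ,Q}(t_m)`
    intro t ht
    have h : ∀ m, (if 0 < t m then w m t else 0) =
        orderTwoPayoff ψ (∑ j, t j) (∑ j, t j ^ 2) (t m) := by
      intro m
      simp only [hw, orderTwoPayoff, sub_sum_erase_eq m t, sum_erase_sq_eq m t]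
    simpa only [h] using hpt t ht

end MaynardCW

open MaynardCW in
/-- **Order-two dual certificate for `M_k`.**  Let `ψ` be as in
`MaynardCW.maynardFunctional_le_of_orderTwoPayoff_sum_le` (jointly measurable; positive and with fibre budgets
`∫_{(0,ℓ]} ψ(u,ℓ,q) du ≤ 1` on the realisable `0 < u ≤ ℓ ≤ 1`, `(1-ℓ)² ≤ n q ≤ n(1-ℓ)²`), and let
`Φ_{σ,Q} = orderTwoPayoff ψ σ Q`.  Suppose that for all `σ, Q` with `0 ≤ σ ≤ 1`, `σ² ≤ (n+1) Q`, `Q ≤ σ²` there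
exist `a, b, c ∈ ℝ` with `Φ_{σ,Q}(u) ≤ c + a u + b u²` for every `u` with `0 ≤ u ≤ σ`, `u² ≤ Q`,
`(σ-u)² ≤ n (Q-u²)`, `Q-u² ≤ (σ-u)²` (all satisfied by `u = t_m` when `∑ t = σ`, `∑ t² = Q`, by Cauchy–Schwarz),
and with `(n+1) c + a σ + b Q ≤ Λ`.  Then `(∑_m J^{(m)}_{n+1}(F))/I_{n+1}(F) ≤ Λ` for every admissible `F`, so
`M_{n+1} ≤ Λ`: indeed `∑_m Φ_{σ,Q}(t_m) ≤ ∑_m (c + a t_m + b t_m²) = (n+1)c + aσ + bQ`.  (At `u = 0` the majorant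
condition reads `0 ≤ c`.)
[cite: Polymath8b2014, Lemma 6.1 and proof of Corollary 6.4 (§6); HardyLittlewoodPolya1952, §2.4 Thm. 7] -/
theorem maynardFunctional_le_of_orderTwo_dual {n : ℕ} {Λ : ℝ} (ψ : ℝ → ℝ → ℝ → ℝ)
    (hψm : Measurable fun p : ℝ × ℝ × ℝ => ψ p.1 p.2.1 p.2.2)
    (hψpos : ∀ u ℓ q : ℝ, 0 < u → u ≤ ℓ → ℓ ≤ 1 → (1 - ℓ) ^ 2 ≤ (n:ℝ) * q → q ≤ (1 - ℓ) ^ 2 →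
      0 < ψ u ℓ q)
    (hnorm : ∀ ℓ q : ℝ, 0 ≤ ℓ → ℓ ≤ 1 → (1 - ℓ) ^ 2 ≤ (n:ℝ) * q → q ≤ (1 - ℓ) ^ 2 →
      ∫⁻ u in Ioc (0:ℝ) ℓ, ENNReal.ofReal (ψ u ℓ q) ≤ 1)
    (hcert : ∀ σ Q : ℝ, 0 ≤ σ → σ ≤ 1 → σ ^ 2 ≤ ((n:ℝ) + 1) * Q → Q ≤ σ ^ 2 →
      ∃ a b c : ℝ,
        (∀ u : ℝ, 0 ≤ u → u ≤ σ → u ^ 2 ≤ Q → (σ - u) ^ 2 ≤ (n:ℝ) * (Q - u ^ 2) →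
            Q - u ^ 2 ≤ (σ - u) ^ 2 → orderTwoPayoff ψ σ Q u ≤ c + a * u + b * u ^ 2) ∧
          ((n:ℝ) + 1) * c + a * σ + b * Q ≤ Λ)
    {F : (Fin (n + 1) → ℝ) → ℝ} (hF : IsMaynardAdmissible (n + 1) F) :
    maynardFunctional (n + 1) F ≤ Λ := by
  have hk : (0:ℝ) < (n:ℝ) + 1 := by positivity
  -- `Λ ≥ 0` from the certificate at `σ = Q = 0`, `u = 0`
  have hΛ0 : 0 ≤ Λ := by
    obtain ⟨a, b, c, hmaj, hle⟩ := hcert 0 0 le_rfl zero_le_one (by simp) (by simp)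
    have hc : 0 ≤ c := by
      have h := hmaj 0 le_rfl le_rfl (by simp) (by simp) (by simp)
      rw [orderTwoPayoff_of_not_pos ψ (lt_irrefl 0)] at h
      simpa using h
    nlinarith
  refine maynardFunctional_le_of_orderTwoPayoff_sum_le ψ hψm hψpos hnorm hΛ0 ?_ hF
  intro t ht
  set σ : ℝ := ∑ j, t j with hσ
  set Q : ℝ := ∑ j, t j ^ 2 with hQ
  have hσ0 : 0 ≤ σ := Finset.sum_nonneg fun j _ => ht.1 j
  have hQσ : Q ≤ σ ^ 2 := Finset.sum_sq_le_sq_sum_of_nonneg fun j _ => ht.1 j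
  have hσQ : σ ^ 2 ≤ ((n:ℝ) + 1) * Q := by
    have h := sq_sum_le_card_mul_sum_sq (s := (univ : Finset (Fin (n + 1)))) (f := t)
    rw [Finset.card_univ, Fintype.card_fin] at h
    simpa using h
  obtain ⟨a, b, c, hmaj, hle⟩ := hcert σ Q hσ0 ht.2 hσQ hQσ
  -- every coordinate is a realisable `u`
  have hterm : ∀ m, orderTwoPayoff ψ σ Q (t m) ≤ c + a * t m + b * t m ^ 2 := by
    intro m
    have h1 : σ - t m = ∑ j ∈ univ.erase m, t j := by rw [sum_erase_eq]
    have h2 : Q - t m ^ 2 = ∑ j ∈ univ.erase m, t j ^ 2 := by rw [sum_erase_sq_eq]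
    refine hmaj (t m) (ht.1 m) ?_ ?_ ?_ ?_
    · exact Finset.single_le_sum (fun j _ => ht.1 j) (Finset.mem_univ m)
    · exact Finset.single_le_sum (f := fun j => t j ^ 2) (fun j _ => sq_nonneg (t j)) (Finset.mem_univ m)
    · rw [h1, h2]; exact sq_sum_erase_le m t
    · rw [h1, h2]; exact Finset.sum_sq_le_sq_sum_of_nonneg fun j _ => ht.1 j
  calc ∑ m, orderTwoPayoff ψ σ Q (t m) ≤ ∑ m, (c + a * t m + b * t m ^ 2) :=
        Finset.sum_le_sum fun m _ => hterm m
    _ = ((n:ℝ) + 1) * c + a * σ + b * Q := by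
        rw [Finset.sum_add_distrib, Finset.sum_add_distrib, Finset.sum_const, Finset.card_univ,
          Fintype.card_fin, nsmul_eq_mul, ← Finset.mul_sum, ← Finset.mul_sum, hσ, hQ]
        push_cast
        ring
    _ ≤ Λ := hle

end Literature.NumberTheory.Sieve
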